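import Mathlib
import HarnessLib
import HarnessLib.Audit
import Summits.CriticalPhenomena.Statement
import Summits.CriticalPhenomena.Ising3DConformalLimit.Theorems.HyperoctahedralRPExistsScaleCovariantLimitSplitGlue
import HarnessLib.Audit.Status.Attr

/-!
Route: PositivityBegetsConformality

# Route PositivityBegetsConformality — inversion positivity (reflection positivity in spheres,
weight Δ) of the critical Ising limit is a closed convex cone inside clause (ii); positivity begets
Möbius covariance

It suffices to show X_P = (IP) ∧ (M) ∧ (E₀) ∧ (NG), realising card positivity-begets-conformality
(spine) and using the group
lemma of card inversion-first-moebius-from-translations as support. (IP) INVERSION POSITIVITY OF THE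
ISING LIMIT: every pointwise
scaling limit S of the critical correlators criticalCorr 3 (ρ > 0 on (0,1]) that is normalised (S =
0 off NonCoincident),
non-degenerate, translation invariant and scale covariant with dimension Δ is INVERSION POSITIVE
with weight Δ: for every finite
family of non-coincident configurations X_a (any arities k_a ≥ 0) in the punctured open unit ball,
the radial Osterwalder–Schrader
Gram matrix M_ab = (∏_i ‖X_b i‖^(−2Δ)) · S_(k_a+k_b)(X_a ⊔ ιX_b), ι(y) = y/‖y‖², is positive
semi-definite (Mathlib
Matrix.PosSemidef over ℝ: symmetric with non-negative quadratic form) — membership of S in a CLOSED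
CONVEX CONE. (M) positivity
begets conformality (support, provable now): such an S is Möbius covariant with dimension Δ — the
symmetry half of PSD is exactly
inversion covariance at sphere-separated configurations (Lemma
PositivityImpliesInversionCovariance), dilations move the sphere,
and translations + the unit inversion generate O(3) (Lemma InversionBegetsRotations) — so neither
rotation invariance nor an
inversion 'upgrade' is an input. (E₀) = ExistsScaleCovariantLimit (shared item 1981: existence
without rotations) and (NG) =
non-Gaussianity (shared item 0636). The first level where (IP) has content beyond isotropy is the
2|2 block of the four-point
function (FourPointConeMembership, partial-wave positivity), filed as the rank-3 milestone crux; the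
1|1 block is the Gegenbauer
generating function, PSD iff Δ ≥ 1/2 = the unitarity bound = the bottom of the rigorous window
[1/2,1] (TwoPointSpherePositivity).
Lean: `InversionPositiveLimit ∧ MoebiusOfInversionPositive ∧ ExistsScaleCovariantLimit ∧
IsingEuclidUpgradeR4NonGaussian` (the four decls below, namespace
Summit.CriticalPhenomena.Ising3DConformalLimit.Theses.PositivityBegetsConformality; every constant
`lean search --decl`-verified: Literature.Probability.LatticeModels.CorrFamily,
HasPointwiseScalingLimit, criticalCorr, NonCoincident, IsNondegenerateTwoPoint,
IsTranslationInvariant, IsScaleCovariant, IsInversionCovariant, IsRotationInvariant,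
IsMoebiusCovariant, HasNontrivialU4, EuclideanGeometry.inversion, Matrix.PosSemidef, Matrix.of,
Fin.append; all nine decls + `theorem assembly_holds : Assembly` elaborate sorry-free in the
planner's Sketch.lean, lean check rc 0)

## Assembly
Pure logic (sorry-free in Sketch.lean, `theorem assembly_holds : Assembly`): take ρ, Δ, S from
ExistsScaleCovariantLimit with its
seven properties; InversionPositiveLimit gives inversion positivity of S with weight Δ;
MoebiusOfInversionPositive turns it into
IsMoebiusCovariant Δ S; IsingEuclidUpgradeR4NonGaussian gives HasNontrivialU4 S; then ⟨ρ, Δ, S, ρ >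
0, Δ > 0, limit,
non-degeneracy, Möbius, U₄⟩ is Literature.Probability.LatticeModels.CritIsing3DConformalLimit =
Ising3DConformalLimit.

Rationale: WHY THIS LINE. Replace the most delicate EQUALITY of clause (ii) — covariance under the unit
inversion, the one Möbius generator no lattice has
and the one the barrier ScaleCovarianceNotMoebius shows is not formal — by an INEQUALITY that
implies it: reflection positivity
through the unit SPHERE with weight Δ (Mack1975, LuscherMack1975: conformal + OS-positive ⇒ radial
OS positivity; here the converse
direction is used, and it is two lines of linear algebra: a PSD Gram matrix is symmetric, and
symmetry of the radial OS form IS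
S(ιZ) = ∏‖z‖^(2Δ) S(Z) once Z is split by the sphere). Inequalities are the native currency of
ferromagnets and of limits: the cone
is closed under pointwise limits (no rate needed), convex, and closed under Schur products (pairing
parts inherit positivity from
the two-point function), and lattice reflection positivity is itself proved by a sum of squares
(FrohlichIsraelLiebSimon1978,
GlimmJaffe1987 ch. 6). Imported areas: axiomatic/conformal QFT (radial quantisation unitarity,
Mack1975; reflection positive
representations of O(1,n+1), NeebOlafsson2014 Thm 6.7), classical harmonic analysis (Gegenbauer
generating function and Askey's
connection-coefficient positivity, AndrewsAskeyRoy1999 (6.4.8) and Thm 7.1.4'; inversion positivity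
of Riesz kernels,
FrankLieb2010), Möbius geometry (a plane reflection is ι∘ι_S∘ι for a unit sphere S through 0,
BenedettiPetronio1992,
FrancescoMathieuSenechal1997 §4.1). What it does that prior routes do not:
IsingEuclidUpgrade/HyperoctahedralRP take isotropy and
the inversion upgrade (items 1980, 1982) as separate equalities to be wrung from the lattice; here
ONE cone condition delivers both,
rotation invariance is output, and the target is testable by eigenvalues/asymmetry of finite
matrices built from correlators.

RANKED CRUXES. #2 InversionPositiveLimit (crux) — (IP) of the card (its P2): for every
renormalisation ρ > 0 on (0,1], every Δ and every S : CorrFamily 3 which is a pointwise scaling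
limit of criticalCorr 3, normalised off NonCoincident, non-degenerate, translation invariant and
scale covariant with dimension Δ, and for every finite family (X_a)_(a<m) of injective
configurations X_a : Fin (k a) → ℝ³ with 0 < ‖X_a i‖ < 1, the real matrix M_ab = (∏_i ‖X_b i‖^(−2Δ))
· S (k a + k b) (Fin.append X_a (ι ∘ X_b)), ι = EuclideanGeometry.inversion 0 1, is
Matrix.PosSemidef (symmetric, Σ c_a c_b M_ab ≥ 0). Radial-quantisation unitarity of the σ field; in
strength = inversion covariance + isotropy of the limit (Mack's converse), in form a closed convex
cone. [difficulty: open-problem] (why it might fail: Fails iff the σ-limit is scale- but not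
Möbius-covariant (a dimension-2 virial current; excluded only by MC, Δ_V > 5) — and no field-blind
RP argument can prove it: RP lattice descendant decoys (Δ ≥ 5/2) are plane-RP yet not inversion
positive, so Δ_σ ≤ 1 / Lebowitz signs must enter.) [Mack1975, LuscherMack1975, NeebOlafsson2014,
FrankLieb2010, FrohlichIsraelLiebSimon1978, GlimmJaffe1987, MenesesEtAl2019,
ElshowkNakayamaRychkov2011, DelamotteTissierWschebor2016, arXiv:2210.13482]
#3 FourPointConeMembership (crux) — (P3) of the card, the first level with content beyond two-point
isotropy: under the same hypotheses on ρ, Δ, S, for every finite family of two-point configurations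
X_a : Fin 2 → ℝ³ in the punctured open unit ball with X_a 0 ≠ X_a 1, the matrix M_ab = ‖X_b 0‖^(−2Δ)
‖X_b 1‖^(−2Δ) · S 4 (X_a 0, X_a 1, ιX_b 0, ιX_b 1) is Matrix.PosSemidef — non-negativity of the
conformal partial-wave content of the critical four-point function in the 2|2 channel through a
sphere; its symmetry half is inversion covariance of S 4 at sphere-separated 2|2 configurations. A
special case of InversionPositiveLimit, independently attackable (pairing part PSD by
TwoPointSpherePositivity ⊗ Schur; the signed Lebowitz correction U₄ ≤ 0 is the whole difficulty) and
independently refutable by Monte Carlo. [difficulty: XL] (why it might fail: A robustly asymmetric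
or indefinite 2|2 radial OS matrix of the bulk critical four-point function in the scaling window
(MC at β_c = 0.22165463, ball radius R ≪ L) refutes it together with clause (ii); no lattice tool
controlling the SIGN of this form (rather than entries) is known.) [doi:10.1007/JHEP08(2015)022,
MenesesEtAl2019, PolandRychkovVichi2019, Mack1975, arXiv:2210.13482, Lebowitz1974]
#4 ExistsScaleCovariantLimit (crux) — (E₀) existence WITHOUT rotations (shared verbatim with route
HyperoctahedralRP, item stmt-CriticalPhenomena-1981): there are ρ > 0 on (0,1], Δ > 0 and S with
HasPointwiseScalingLimit (criticalCorr 3) ρ S, S = 0 off NonCoincident, IsNondegenerateTwoPoint S,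
IsTranslationInvariant S, IsScaleCovariant Δ S. Strictly weaker than CritIsing3DEuclideanLimit (item
0638); on this route isotropy and inversion are OUTPUT of (IP). [difficulty: open-problem] (why it
might fail: Full δ→0⁺ convergence with ONE continuous Δ is open on ℤ³: the two-point bounds give
only subsequential limits, no uniqueness mechanism exists in d = 3, and RP/GKS two-point axiomatics
admit log-periodic (discretely scale-covariant) profiles.) [DuminilCopinICM2022,
DuminilcopinPanis2025, AizenmanDuminilCopinAnnals2021,
Literature.Probability.LatticeModels.CritIsing3DEuclideanLimit]
#5 IsingEuclidUpgradeR4NonGaussian (crux) — (NG) non-triviality in d = 3 (shared verbatim, item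
stmt-CriticalPhenomena-0636): every non-degenerate pointwise scaling limit S of the renormalised
critical Ising correlators on ℤ³ has connected four-point function U₄ ≢ 0 on non-coincident
configurations (random-current intersection identity, Aizenman 1982 / ADC 2021 eq. (3.11)). Clause
(iii); imported, not addressed by this card. [difficulty: open-problem] (why it might fail: No proof
that U₄ ≢ 0 in d = 3: the double-current intersection probability at macroscopic separation must
stay > 0 as δ → 0; RP long-range models ON ℤ³ (α < 3/2) are Gaussian (LongRangeTrivialityOnZ3), and
d ≥ 4 is Gaussian.) [AizenmanDuminilCopinAnnals2021, DuminilCopinICM2022, Panis2023Triviality,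
Literature.Barriers.CriticalPhenomena.LongRangeTrivialityOnZ3]
#9 MoebiusOfInversionPositive (support) — (M), the glue used in the assembly (card P0 + P4): for ρ >
0 on (0,1], Δ, S a pointwise scaling limit of criticalCorr 3 normalised off NonCoincident,
non-degenerate, translation invariant, scale covariant with Δ, and inversion positive with weight Δ
(the conclusion of InversionPositiveLimit, verbatim), S is IsMoebiusCovariant Δ. Proof plan
(provable now): permutation symmetry of S (criticalCorr is a spin-monomial expectation, symmetric;
limits are unique on NonCoincident; 0 = 0 off it) + PositivityImpliesInversionCovariance +
InversionBegetsRotations, then IsMoebiusCovariant := ⟨⟨translation, rotation⟩, scale, inversion⟩.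
[difficulty: provable-now] [FrancescoMathieuSenechal1997, GlimmJaffe1987, BenedettiPetronio1992,
Mack1975]
#9 PositivityImpliesInversionCovariance (support) — the Lemma (card P0), abstract over CorrFamily 3:
if S vanishes off NonCoincident, is permutation symmetric (S n (z ∘ σ) = S n z), scale covariant
with Δ and inversion positive with weight Δ (same matrix family as in InversionPositiveLimit), then
IsInversionCovariant Δ S. Proof: PosSemidef ⇒ symmetric Gram matrix, w(Y)S(X ⊔ ιY) = w(X)S(Y ⊔ ιX);
a configuration Z avoiding 0 and the unit sphere splits as Z = X ⊔ ιY with X = Z ∩ B, Y = ι(Z ∖ B̄),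
and the symmetry is S(ιZ) = ∏‖z‖^(2Δ) S(Z) after a permutation; configurations touching the unit
sphere: inversion positivity w.r.t. the sphere of radius r follows by scale covariance (D_r
conjugation multiplies M by a positive diagonal matrix on both sides), pick r ∉ {‖z_i‖} and use ι =
D_(1/r²) ∘ ι_r; coincident configurations: both sides vanish (ι injective). Arity-0 configurations
are allowed (S 0 of the empty configuration is the vacuum entry). [difficulty: provable-now]
[GlimmJaffe1987, OsterwalderSchrader1973, Mack1975, FrancescoMathieuSenechal1997]
#9 InversionBegetsRotations (support) — the group lemma (card P4 = A0 of
inversion-first-moebius-from-translations, in the form its novelty audit recommended recording): for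
any Δ and any S : CorrFamily 3, IsTranslationInvariant S and IsInversionCovariant Δ S imply
IsRotationInvariant S (all of O(3)); no continuity, no scale covariance, no normalisation needed.
Proof: the reflection in the plane {y · a = 1/2}, ‖a‖ = 1, equals ι ∘ τ_a ∘ ι ∘ τ_(−a) ∘ ι pointwise
off the poles {0, a} (a plane reflection is the ι-conjugate of the inversion in the unit sphere
through 0 centred at a; checked numerically), and the three inversion weights multiply to 1 (‖w'‖·‖z
− a‖·‖y‖ = 1); for a plane through 0 and a given configuration x conjugate by a translation u with u
· v = 1/2 avoiding the finitely many u that put a point on a pole; O(3) is generated by reflections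
(Mathlib LinearIsometryEquiv.reflections_generate / Cartan–Dieudonné). [difficulty: provable-now]
[FrancescoMathieuSenechal1997, BenedettiPetronio1992, doi:10.1007/978-3-319-43626-5_3]
#9 TwoPointSpherePositivity (support) — the 1|1 level is classical analysis (card P1): for Δ > 0,
the kernel K_Δ(x,y) = ‖y‖^(−2Δ)‖x − ιy‖^(−2Δ) = (1 − 2⟨x,y⟩ + ‖x‖²‖y‖²)^(−Δ) gives Matrix.PosSemidef
matrices for all finite families in the punctured open unit ball of ℝ³ IF AND ONLY IF Δ ≥ 1/2. (⇐)
Gegenbauer generating function Σ_n (‖x‖‖y‖)^n C_n^(Δ)(x̂·ŷ) (AndrewsAskeyRoy1999 (6.4.8)),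
connection coefficients C_n^(Δ) → Legendre C_k^(1/2) non-negative for Δ ≥ 1/2 (Thm 7.1.4'), zonal
Legendre kernels PSD on S² (addition theorem / Schoenberg 1942), Schur products and limits;
equivalently sphere-reflection positivity of ‖x − y‖^(−s), n − 2 ≤ s (NeebOlafsson2014 Thm 6.7,
FrankLieb2010). (⇒) for 0 < Δ < 1/2 the P₀-coefficient of C₂^(Δ) is Δ(2Δ−1)/3 < 0 and the regular
octahedron (a spherical 3-design) at radii 2r and r with weights ±1/6 gives quadratic form
Δ(2Δ−1)/3·9r⁴ + O(r⁸) < 0 for small r (verified numerically down to Δ = 0.4999). So the two-point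
level of (IP) is automatic exactly on the rigorous Ising window Δ ∈ [1/2,1]
(scalingDimension_mem_Icc_holds) once S₂ is isotropic, and conversely the 1|1 level of (IP) is
EQUIVALENT to two-point isotropy there. [difficulty: L] [AndrewsAskeyRoy1999, NeebOlafsson2014,
FrankLieb2010, doi:10.1215/S0012-7094-42-00908-6, BergChristensenRessel1984]

TWO-LAYER PLAN. MoebiusOfInversionPositive ⇐ PositivityImpliesInversionCovariance →
InversionBegetsRotations → MoebiusOfInversionPositive (glue:
permutation symmetry of Ising limits + packaging; both children already filed as support, provable
now). InversionPositiveLimit ⇐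
LatticeRadialPositivity → ConeIsClosed → InversionPositiveLimit once a prover fixes the lattice
dictionary: LatticeRadialPositivity
= asymptotic non-negativity (≥ −o(1)·‖c‖²) of the same quadratic form built from criticalCorr 3 at
spins [X/δ], [ιX/δ] with weights
(ρ(δ)-free: the weights are ratios) — engines on the card: (i) random-current expansion, pairing
part PSD by TwoPointSpherePositivity ⊗
Schur and domination of the signed Lebowitz correction; (ii) positivity of Θ_r ∘ E[· | outside the
discrete sphere S_r] on inside
observables (domain-Markov property makes it an operator statement); (iii) comparison with an
exactly inversion-RP regularisation
(S² × ℤ radial lattice) where only an inequality must survive; ConeIsClosed = pointwise limits of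
PSD matrices are PSD (trivial glue).
FourPointConeMembership ⇐ PairingPartPositive (provable from TwoPointSpherePositivity given
two-point isotropy) → LebowitzCorrectionDominated.

KILL CRITERIA. A normalised translation-invariant scale-covariant Ising limit that is NOT inversion
positive (¬InversionPositiveLimit), or an
indefinite/asymmetric 2|2 block (¬FourPointConeMembership), refutes clause (ii) of the conjunct
itself for that limit (plane-RP +
Möbius ⇒ sphere-RP, Mack's converse) — file ¬Ising3DConformalLimit-type evidence; every covariance
route dies, not only this one.
Route-specific: a refutation of MoebiusOfInversionPositive / PositivityImpliesInversionCovariance /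
InversionBegetsRotations can only be
a typing slip (poles, sphere-touching or coincident configurations) — repair by --restate, never
close. If HyperoctahedralRP's
LimitRotationInvariant (1980) and InversionUpgradeNormalised (1982) are both proved, (IP) follows
from them by Mack's converse and the
route is superseded (close --reason superseded --by route-CriticalPhenomena-HyperoctahedralRP), its
support lemmas surviving as
Literature-level facts. Refutation of ExistsScaleCovariantLimit or of 0636 kills the conjunct as
typed (shared with all routes).

NOT DECOMPOSED YET. The lattice dictionary of (IP) (which discrete spheres, block-averaged or
pointwise insertions, the o(1) bookkeeping) and the choice
among engines (i)–(iii); the n-point real-analyticity/continuity that would let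
FourPointConeMembership propagate inversion covariance
of S₄ from sphere-separable to all configurations; the definition IsInversionPositive as a
Literature notion (requested; statements
inline it for now); Gegenbauer polynomials in Lean (TwoPointSpherePositivity may be discharged by
citation as a named fact first);
any decomposition of the shared cruxes 1981 / 0636 (owned by the existence and non-Gaussianity
lines).

CHEAPEST FALSIFIER. Consistency checks run by the planner (pure-python, folder checks/sanity.py):
(1) the generalised free field (hafnian of ‖x−y‖^(−2Δ),
Δ = 1/2, 3/4; a unitary Möbius theory) gives symmetric PSD radial Gram matrices over mixed arities
0,1,2 — consistent with (IP)+(M);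
(2) the catalogued witness of ScaleCovarianceNotMoebius (S₂ = ‖x−y‖⁻¹, S₄ = Σ pairs ‖x_i−x_j‖⁻²) has
a 2|2 block with relative
asymmetry 2.1 and indefinite symmetric part — it is not inversion positive, as the Lemma demands of
a non-covariant family; (3) the
1|1 threshold: octahedron-at-two-radii form negative for Δ = 0.1…0.4999, PSD spectra for Δ = 0.5…2.
The cheapest EXTERNAL kill is the
asymmetry test of the 2|2 block on bulk Monte-Carlo four-point data at β_c(3) = 0.22165463 (spins at
[X/δ], [ιY/δ] in a ball R ≪ L,
weights with Δ = 0.518): |M_ab − M_ba|/M = O(1) persisting as δ → 0 refutes FourPointConeMembership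
and clause (ii); existing
ball-geometry and fuzzy-sphere numerics (doi:10.1007/JHEP08(2015)022, arXiv:2210.13482:
integer-spaced radial-quantisation spectrum
with positive norms) are consistent with positivity. Not run here (hub compute-free, one-shot
plancard).

NUMBERS. Δ_σ = 0.5181489(10), η = 0.0362978(20) (PolandRychkovVichi2019 Table II); rigorous window Δ
∈ [1/2, 1] for any non-degenerate
scale-covariant limit (Literature.Probability.LatticeModels.scalingDimension_mem_Icc_holds, from
c‖x‖⁻² ≤ ⟨σ₀σ_x⟩ ≤ C‖x‖⁻¹);
1|1 positivity threshold Δ = 1/2 = (d−2)/2 = unitarity bound = Frank–Lieb/Neeb–Ólafsson threshold s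
= n − 2 (NeebOlafsson2014
Thm 6.7: s = 0 or n − 2 ≤ s < n); C₂^(λ) = (4λ(λ+1)/3)P₂ + (λ(2λ−1)/3)P₀ (sign change at λ = 1/2);
virial-current exclusion
Δ_V > 5.0 (MenesesEtAl2019); RP descendant decoys live at Δ ≥ 5/2 (cards
rp-descendant-witness-barrier, maxwell-square-rp-witness).
Items at open: 9 (4 cruxes, 4 support, 1 assembly).

DEFINITION REQUESTS. (1) notion IsInversionPositive (Δ : ℝ) (S : CorrFamily d) : Prop — PosSemidef
of the radial OS Gram matrices over finite families
of injective configurations in the punctured open unit ball, all arities (exactly the inlined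
conclusion of InversionPositiveLimit),
topic Literature/Probability/LatticeModels (next to IsInversionCovariant in
ConformalCovariance.lean), --for InversionPositiveLimit;
once landed the three statements inlining it can be shortened by --restate without change of
meaning. (2) cite fact wanted:
sphere-reflection positivity of the Riesz kernel ‖x − y‖^(−s) on ℝⁿ for n − 2 ≤ s < n
(NeebOlafsson2014 Thm 6.7; FrankLieb2010
Thm 2.? 'inversion positivity'), family crit-ising, trunk Probability/LatticeModels — would
discharge the (⇐) half of
TwoPointSpherePositivity for 1/2 ≤ Δ < 3/2 by citation.

Novelty: Searches (2026-08-15): `lit search --hybrid "reflection positivity sphere inversion conformal group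
complementary series"` (10 book
hits: Möbius/Lie-sphere geometry texts, GlimmJaffe1987 pp.130–132, Montvay–Münster — none on
sphere-RP of lattice limits); `lit search
--hybrid "Osterwalder-Schrader positivity conformal invariant QFT radial quantization unitarity"`
(DMS 1997, Haag — textbook radial
quantisation); `lit search --source crossref "reflection positivity conformal symmetry spheres
inversion"` (6: NeebOlafsson2014
doi:10.1016/j.jfa.2013.10.030, Neeb–Ólafsson 2020 doi:10.1007/s13324-019-00353-3 = arXiv:1907.09383
READ — RP for fields ON Sⁿ w.r.t.
the equator, Dimock/Jaffe–Ritter setting, not ours); `lit read arXiv:1206.2039` p.4 and Thm 6.7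
(p.24) READ; `lit read
book:andrews1999-special-functions` pp.215 (6.4.8), 254 (Thm 7.1.4'); `lit frontier
CriticalPhenomena --since 2021` (30 rows, none on
RP/conformal upgrade; arXiv:2604.05772 percolation in 3D Ising noted); `lit bridges
CriticalPhenomena --cross any`; `lit galaxy search
"reflection positivity with respect to spheres conformal" / "inversion positivity" --star all`
(galaxyd saturated: 0 + 2 irrelevant
pdf hits, logged); arXiv/OpenAlex APIs rate-limited (429), logged; pool scan of the 105 cards of the
sub and the 5 route files; the
card's own audit (refuter-novelty-audit-…-7-0: new-combination; prior NeebOlafsson2014,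
FrankLieb2010, Mack1975).
Nearest prior art found: Mack1975 / LuscherMack1975 (conformal invariance  [refs: 10.1016/j.jfa.2013.10.030, 10.1007/s13324-019-00353-3, 1907.09383, 1206.2039, 2604.05772, doi:10.1016/j.jfa.2013.10.030, doi:10.1007/s13324-019-00353-3, book:andrews1999-special-functions, GlimmJaffe1987, NeebOlafsson2014, FrankLieb2010, Mack1975, LuscherMack1975]

Barriers (technique_class: sphere-reflection-positivity, inversion-first): - technique_class: sphere-reflection-positivity, inversion-first
- Literature.Barriers.CriticalPhenomena.ScaleCovarianceNotMoebius: evaded in type and checked in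
substance — no step upgrades Euclidean+scale data (class EuclideanScaleUpgrade unused; (IP) keeps
HasPointwiseScalingLimit (criticalCorr 3) and the NonCoincident normalisation); the barrier's
witness is provably outside the cone (its 2|2 block is asymmetric, planner's check), exactly as
PositivityImpliesInversionCovariance requires of any non-covariant family. Honest weight: (IP) is
not weaker than (U)+isotropy, only convex, closed and testable.
- Literature.Barriers.CriticalPhenomena.LiouvilleRigidity: respected and used as a resource — only
Möbius covariance is targeted; one sphere plus translations generate Möb(3) ⊇ O(3)
(InversionBegetsRotations); no planar maps, SLE or discrete holomorphicity.
- Literature.Barriers.CriticalPhenomena.BootstrapLatticeBlindness: not in class —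
partial-wave/radial positivity is a property OF the lattice limit to be proved from criticalCorr 3
(lattice RP, correlation inequalities, Markov property), never assumed from CFT axioms; no bootstrap
output enters.
- Literature.Barriers.CriticalPhenomena.LongRangeTrivialityOnZ3: applies to clause (iii) only,
imported as the shared item 0636; the positivity mechanism makes no non-triviality claim (and RP
long-range Gaussian limits ARE inversion positive generalised free fields for Δ ≥ 1/2 — consistent).
- Literature.Barriers.CriticalPhenomena.

History (route lifecycle, newest last):
- 2026-08-25T16:08:03Z · DORMANT — reconciler: no traction for 7.8 d (last activity item-evidence-added at 2026-08-17T19:18:53Z); parked, not closed — `ledger route dormant route-CriticalPhenomen (operator:999:2726555)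
- 2026-08-27T15:30:43Z · REACTIVATED — reconciler: reactivated — activity statement-checked at 2026-08-27T13:51:04Z after parking at 2026-08-25T16:08:03Z (operator:999:2319951)

sub-problem: Ising3DConformalLimit · status: open · opened planner-plancard-CriticalPhenomena-Ising3DCon-6ac38875-0 2026-08-15T11:34:47Z · rev 4 · ledger route-CriticalPhenomena-PositivityBegetsConformality
GENERATED by the gate from the ledger (D-0016/17). Provers cite these decls: `theorem foo : Summit.CriticalPhenomena.Ising3DConformalLimit.Theses.PositivityBegetsConformality.<Decl> := …` in Summits/CriticalPhenomena/Ising3DConformalLimit/Theorems/<Name>.lean.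
-/

namespace Summit.CriticalPhenomena.Ising3DConformalLimit.Theses.PositivityBegetsConformality

open scoped BigOperators Topology Manifold Classical MeasureTheory ProbabilityTheory Matrix InnerProductSpace ComplexConjugate ContinuousMap
open Filter Set Function TopologicalSpace MeasureTheory

attribute [summit_statement] _root_.Ising3DConformalLimit

/-- item stmt-CriticalPhenomena-4671 · crux · rank 2 · open · by planner
why it might fail: Equivalent to clause (ii) given lattice plane-RP (Mack's converse): fails iff the σ-limit is scale- but not Möbius-covariant (dimension-2 virial current, excluded only by MC Δ_V > 5 and NPRG heuristics); plane-RP descendant decoys (Δ ≥ 5/2) bar field-blind RP proofs: Δ_σ ≤ 1/Lebowitz must enter.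
sources: Mack1975, LuscherMack1975, arXiv:1511.03180, MenesesEtAl2019, DelamotteTissierWschebor2016, ElshowkNakayamaRychkov2011
[crux] (IP) of the card (its P2): for every renormalisation ρ > 0 on (0,1], every Δ and every S :
CorrFamily 3 which is a pointwise scaling limit of criticalCorr 3, normalised off NonCoincident,
non-degenerate, translation invariant and scale covariant with dimension Δ, and for every finite
family (X_a)_(a<m) of injective configurations X_a : Fin (k a) → ℝ³ with 0 < ‖X_a i‖ < 1, the real
matrix M_ab = (∏_i ‖X_b i‖^(−2Δ)) · S (k a + k b) (Fin.append X_a (ι ∘ X_b)), ι =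
EuclideanGeometry.inversion 0 1, is Matrix.PosSemidef (symmetric, Σ c_a c_b M_ab ≥ 0).
Radial-quantisation unitarity of the σ field; in strength = inversion covariance + isotropy of the
limit (Mack's converse), in form a closed convex cone. [difficulty: open-problem] -/
@[route_item "route-CriticalPhenomena-PositivityBegetsConformality", crux]
def InversionPositiveLimit : Prop :=
  ∀ (ρ : ℝ → ℝ) (Δ : ℝ) (S : Literature.Probability.LatticeModels.CorrFamily 3), (∀ δ ∈ Set.Ioc (0:ℝ) 1, 0 < ρ δ) → Literature.Probability.LatticeModels.HasPointwiseScalingLimit (Literature.Probability.LatticeModels.criticalCorr 3) ρ S → (∀ n z, z ∉ Literature.Probability.LatticeModels.NonCoincident 3 n → S n z = 0) → Literature.Probability.LatticeModels.IsNondegenerateTwoPoint S → Literature.Probability.LatticeModels.IsTranslationInvariant S → Literature.Probability.LatticeModels.IsScaleCovariant Δ S → ∀ (m : ℕ) (k : Fin m → ℕ) (X : (a : Fin m) → Fin (k a) → EuclideanSpace ℝ (Fin 3)), (∀ a i, X a i ≠ 0 ∧ ‖X a i‖ < 1) → (∀ a, Function.Injective (X a)) → (Matrix.of fun a b : Fin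 m => (∏ i, ‖X b i‖ ^ (-(2 * Δ))) * S (k a + k b) (Fin.append (X a) (fun i => EuclideanGeometry.inversion 0 1 (X b i)))).PosSemidef

/-- item stmt-CriticalPhenomena-1981 · crux · rank 4 · SPLIT (gen 2) into TwoPointDoubling, ClusterSetTotallyDisconnected + glue Summit.CriticalPhenomena.Ising3DConformalLimit.Cruxes.ExistsScaleCovariantLimit.SplitGlue.hrp_crux_of_doubling_of_totallyDisconnected · direct attempts still welcome (low priority) · by planner
why it might fail: Full δ→0⁺ convergence with ONE continuous Δ is open on ℤ³: the two-point bounds give only subsequential limits, no uniqueness mechanism exists in d = 3, and RP/GKS two-point axiomatics admit log-periodic (discretely scale-covariant) profiles.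
sources: DuminilCopinICM2022, DuminilcopinPanis2025, AizenmanDuminilCopinAnnals2021, Literature.Probability.LatticeModels.CritIsing3DEuclideanLimit
earlier split gen 1: TwoPointDoubling, ClusterSetTotallyDisconnected — retired -
[crux r4, (C), existence WITHOUT rotations] There are ρ > 0 on (0,1], Δ > 0 and S with
HasPointwiseScalingLimit (criticalCorr 3) ρ S, S = 0 off NonCoincident, IsNondegenerateTwoPoint S,
IsTranslationInvariant S, IsScaleCovariant Δ S. Strictly weaker than CritIsing3DEuclideanLimit (item
0638: rotations included) — on this route isotropy is OUTPUT. Inputs in tree: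
criticalTwoPoint_bounds_holds (c|x|⁻² ≤ G ≤ C|x|⁻¹ ⇒ subsequential limits, Δ ∈ [1/2,1]); missing:
uniqueness/full-filter convergence and continuous scale covariance (DuminilCopinICM2022 §8.4 p.29:
'widely open'). -/
@[route_item "route-CriticalPhenomena-PositivityBegetsConformality", crux]
def ExistsScaleCovariantLimit : Prop :=
  ∃ (ρ : ℝ → ℝ) (Δ : ℝ) (S : Literature.Probability.LatticeModels.CorrFamily 3), (∀ δ ∈ Set.Ioc (0:ℝ) 1, 0 < ρ δ) ∧ 0 < Δ ∧ Literature.Probability.LatticeModels.HasPointwiseScalingLimit (Literature.Probability.LatticeModels.criticalCorr 3) ρ S ∧ (∀ n z, z ∉ Literature.Probability.LatticeModels.NonCoincident 3 n → S n z = 0) ∧ Literature.Probability.LatticeModels.IsNondegenerateTwoPoint S ∧ Literature.Probability.LatticeModels.IsTranslationInvariant S ∧ Literature.Probability.LatticeModels.IsScaleCovariant Δ S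

-- parent: ExistsScaleCovariantLimit · child (gen 2)
/--     item stmt-CriticalPhenomena-6150 · crux · rank 401 · open
    parent: ExistsScaleCovariantLimit · by planner
    why it might fail: Open in print (ADC21 Rem 5.10): RP in all mirrors, MMS, IR + sliding-scale IR, DCP24 Thm 1.2/1.3 and the log-gradient bound admit completely monotone profiles with exponential episodes breaking doubling by n₀^(−1/2) (Disproof §E W_ε; barrier p149925); needs an Ising-specific two-scale lower bound.
    sources: AizenmanDuminilCopinAnnals2021, arXiv:1912.07973, DuminilcopinPanis2025, arXiv:2404.05700, DuminilCopinICM2022, arXiv:2509.02850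
[crux] (D) ALL-SCALE DOUBLING of the axial critical two-point function on ℤ³: there is κ > 0 with
g(2n) ≥ κ·g(n) for all n ≥ 1, g(n) := ⟨σ₀σ_{n e₁}⟩⁺_{β_c(3)} (card item M3; = D1 of card
every-scale-regular-multiplicative-fekete). With MMS it gives G(z′) ≍ G(z) for ‖z′‖ ≍ ‖z‖ in all
directions; it is the one open LATTICE input of the compactness half and is filed first (the import
cone of everything below is otherwise proved: criticalTwoPoint_bounds_holds,
messager_miracleSole_holds, RP lemmas). [difficulty: open-problem] -/
@[route_item "route-CriticalPhenomena-PositivityBegetsConformality", crux]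
def TwoPointDoubling : Prop :=
  ∃ κ : ℝ, 0 < κ ∧ ∀ n : ℕ, 1 ≤ n → κ * Literature.Probability.LatticeModels.criticalTwoPoint 3 (Pi.single 0 (n : ℤ)) ≤ Literature.Probability.LatticeModels.criticalTwoPoint 3 (Pi.single 0 (2 * (n : ℤ)))

-- parent: ExistsScaleCovariantLimit · child (gen 2)
/--     item stmt-CriticalPhenomena-4659 · crux · rank 402 · open
    parent: ExistsScaleCovariantLimit · by planner
    why it might fail: Uniqueness given compactness: fails if Δ drifts along scales (arc of pure-power cluster points), if the zoom has a limit cycle (DSI witnesses W_ε pass all two-point axiomatics, Disproof §E), or if cluster points evade locality; isolation of local 3D CFTs is expected, not proved (Rychkov2020 p.8).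
    sources: Rychkov2020, arXiv:2007.14315, PolandRychkovVichi2019, arXiv:1805.04405, DuminilCopinICM2022, Literature.Probability.LatticeModels.PointwiseScalingLimitDiscreteScaleInvariance
[crux] the cluster set 𝒞 of the self-normalised family is totally disconnected in the pointwise
(product) topology of CorrFamily 3 (on 𝒞, compact under Reg, this coincides with the locally uniform
topology; pointwise is the stronger ask otherwise). INTENDED ENGINE (card items (2)–(4), the route's
point, layer 2): 𝒞 ⊆ 𝓘 := σ-correlator families of LOCAL unitary ℤ₂-symmetric 3D CFTs with exactly
one relevant odd and exactly one relevant non-identity even scalar and Δ_σ ≤ 1 (lattice side: OS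
positivity, clustering, covariance and spectrum of cluster points), and 𝓘 is totally disconnected
(CFT side, lattice-blind: 'It is expected that most local CFTs are isolated. One exception are CFTs
with exactly marginal fields of dimension Δ = d … A folk conjecture says that exactly marginal
fields in d ≥ 3 require supersymmetry' — Rychkov2020, arXiv:2007.14315 p.8, read this session; LOCAL
= 'critical points of lattice models with finite-range interactions', ibid., which is what excludes
the non-local long-range arc; an ANALYTIC isolation theorem for exact solutions of crossing — NOT a
finite-Λ positivity certificate, which only gives diam ≤ ε(Λ): refuter flag on the card, accepted).
Both halves -/
@[route_item "route-CriticalPhenomena-PositivityBegetsConformality", crux]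
def ClusterSetTotallyDisconnected : Prop :=
  IsTotallyDisconnected {S : Literature.Probability.LatticeModels.CorrFamily 3 | (∀ n x, x ∉ Literature.Probability.LatticeModels.NonCoincident 3 n → S n x = 0) ∧ ∃ u : ℕ → ℝ, (∀ k, u k ∈ Set.Ioc (0:ℝ) 1) ∧ Filter.Tendsto u Filter.atTop (nhds 0) ∧ ∀ n, TendstoLocallyUniformlyOn (fun k => Literature.Probability.LatticeModels.rescaledCorrelator (Literature.Probability.LatticeModels.criticalCorr 3) (fun δ : ℝ => (Literature.Probability.LatticeModels.criticalTwoPoint 3 (Pi.single 0 ⌊δ⁻¹⌋)) ^ (-(1/2:ℝ))) n (u k)) (S n) Filter.atTop (Literature.Probability.LatticeModels.NonCoincident 3 n)}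

/-- glue for the split of `ExistsScaleCovariantLimit`: landed theorem `Summit.CriticalPhenomena.Ising3DConformalLimit.Cruxes.ExistsScaleCovariantLimit.SplitGlue.hrp_crux_of_doubling_of_totallyDisconnected`. -/
theorem ExistsScaleCovariantLimitGlueBy_holds : TwoPointDoubling → ClusterSetTotallyDisconnected → ExistsScaleCovariantLimit := _root_.Summit.CriticalPhenomena.Ising3DConformalLimit.Cruxes.ExistsScaleCovariantLimit.SplitGlue.hrp_crux_of_doubling_of_totallyDisconnected

/-- item stmt-CriticalPhenomena-0636 · crux · rank 5 · open · by planner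
why it might fail: No proof that U₄ ≢ 0 in d = 3: the double-current intersection probability at macroscopic separation must stay > 0 as δ → 0; RP long-range models ON ℤ³ (α < 3/2) are Gaussian (LongRangeTrivialityOnZ3), and d ≥ 4 is Gaussian.
sources: AizenmanDuminilCopinAnnals2021, DuminilCopinICM2022, Panis2023Triviality, Aizenman1982, Literature.Barriers.CriticalPhenomena.LongRangeTrivialityOnZ3
Crux r4 (non-triviality in d=3): every non-degenerate pointwise scaling limit S of the renormalised
critical Ising correlators on Z^3 has connected four-point function U4 ≢ 0 on non-coincident
configurations. Intended tool: the random-current identity U4(x,y,z,t) =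
−2⟨σxσy⟩⟨σzσt⟩·P^{xy,zt}[C_{n1+n2}(x) ∩ C_{n1+n2}(z) ≠ ∅] (Aizenman 1982; ADC2021 arXiv:1912.07973
eq. (3.11)): non-Gaussianity ⇔ the intersection probability of the two double-current clusters at
macroscopic separation does not vanish as δ → 0. Contrast: for d ≥ 4 every such limit IS Gaussian
(Literature.Probability.LatticeModels.highDim_triviality). Its negation refutes the conjunct
Ising3DConformalLimit itself. -/
@[route_item "route-CriticalPhenomena-PositivityBegetsConformality", crux]
def IsingEuclidUpgradeR4NonGaussian : Prop :=
  ∀ (ρ : ℝ → ℝ) (S : Literature.Probability.LatticeModels.CorrFamily 3), (∀ δ ∈ Set.Ioc (0:ℝ) 1, 0 < ρ δ) → Literature.Probability.LatticeModels.HasPointwiseScalingLimit (Literature.Probability.LatticeModels.criticalCorr 3) ρ S → Literature.Probability.LatticeModels.IsNondegenerateTwoPoint S → Literature.Probability.LatticeModels.HasNontrivialU4 S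

/-- item stmt-CriticalPhenomena-4672 · aside · rank 3 · open · by planner
why it might fail: An asymmetric or indefinite 2|2 radial OS matrix of the bulk critical four-point function (MC at β_c = 0.22165463, ball R ≪ L, weights Δ = 0.518) persisting as δ → 0 refutes it and clause (ii); no lattice tool controls the SIGN of this form: Lebowitz U₄ ≤ 0 is entrywise, only the pairing part PSD.
sources: doi:10.1007/JHEP08(2015)022, MenesesEtAl2019, PolandRychkovVichi2019, Mack1975, arXiv:2210.13482, Lebowitz1974
[crux] (P3) of the card, the first level with content beyond two-point isotropy: under the same
hypotheses on ρ, Δ, S, for every finite family of two-point configurations X_a : Fin 2 → ℝ³ in the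
punctured open unit ball with X_a 0 ≠ X_a 1, the matrix M_ab = ‖X_b 0‖^(−2Δ) ‖X_b 1‖^(−2Δ) · S 4
(X_a 0, X_a 1, ιX_b 0, ιX_b 1) is Matrix.PosSemidef — non-negativity of the conformal partial-wave
content of the critical four-point function in the 2|2 channel through a sphere; its symmetry half
is inversion covariance of S 4 at sphere-separated 2|2 configurations. A special case of
InversionPositiveLimit, independently attackable (pairing part PSD by TwoPointSpherePositivity ⊗
Schur; the signed Lebowitz correction U₄ ≤ 0 is the whole difficulty) and independently refutable by
Monte Carlo. [difficulty: XL] -/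
@[route_item "route-CriticalPhenomena-PositivityBegetsConformality"]
def FourPointConeMembership : Prop :=
  ∀ (ρ : ℝ → ℝ) (Δ : ℝ) (S : Literature.Probability.LatticeModels.CorrFamily 3), (∀ δ ∈ Set.Ioc (0:ℝ) 1, 0 < ρ δ) → Literature.Probability.LatticeModels.HasPointwiseScalingLimit (Literature.Probability.LatticeModels.criticalCorr 3) ρ S → (∀ n z, z ∉ Literature.Probability.LatticeModels.NonCoincident 3 n → S n z = 0) → Literature.Probability.LatticeModels.IsNondegenerateTwoPoint S → Literature.Probability.LatticeModels.IsTranslationInvariant S → Literature.Probability.LatticeModels.IsScaleCovariant Δ S → ∀ (m : ℕ) (X : Fin m → Fin 2 → EuclideanSpace ℝ (Fin 3)), (∀ a i, X a i ≠ 0 ∧ ‖X a i‖ < 1) → (∀ a, X a 0 ≠ X a 1) → (Matrix.of fun a b : Fin m => (∏ i, ‖X b i‖ ^ (-(2 * Δ))) * S 4 (Fin.append (X a) (fun i => EuclideanGeometry.inversion 0 1 (X b i)))).PosSemidef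

/-- item stmt-CriticalPhenomena-4673 · support · rank 9 · closed · proved by Summit.CriticalPhenomena.Ising3DConformalLimit.PositivityBegetsConformalityMoebiusOfInversionPositive.moebiusOfInversionPositive_proof @ 26ff6b64475b (prover) · by planner
sources: FrancescoMathieuSenechal1997, GlimmJaffe1987, BenedettiPetronio1992, Mack1975
[support] (M), the glue used in the assembly (card P0 + P4): for ρ > 0 on (0,1], Δ, S a pointwise
scaling limit of criticalCorr 3 normalised off NonCoincident, non-degenerate, translation invariant,
scale covariant with Δ, and inversion positive with weight Δ (the conclusion of
InversionPositiveLimit, verbatim), S is IsMoebiusCovariant Δ. Proof plan (provable now): permutation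
symmetry of S (criticalCorr is a spin-monomial expectation, symmetric; limits are unique on
NonCoincident; 0 = 0 off it) + PositivityImpliesInversionCovariance + InversionBegetsRotations, then
IsMoebiusCovariant := ⟨⟨translation, rotation⟩, scale, inversion⟩. [difficulty: provable-now] -/
@[route_item "route-CriticalPhenomena-PositivityBegetsConformality", crux]
def MoebiusOfInversionPositive : Prop :=
  ∀ (ρ : ℝ → ℝ) (Δ : ℝ) (S : Literature.Probability.LatticeModels.CorrFamily 3), (∀ δ ∈ Set.Ioc (0:ℝ) 1, 0 < ρ δ) → Literature.Probability.LatticeModels.HasPointwiseScalingLimit (Literature.Probability.LatticeModels.criticalCorr 3) ρ S → (∀ n z, z ∉ Literature.Probability.LatticeModels.NonCoincident 3 n → S n z = 0) → Literature.Probability.LatticeModels.IsNondegenerateTwoPoint S → Literature.Probability.LatticeModels.IsTranslationInvariant S → Literature.Probability.LatticeModels.IsScaleCovariant Δ S → (∀ (m : ℕ) (k : Fin m → ℕ) (X : (a : Fin m) → Fin (k a) → EuclideanSpace ℝ (Fin 3)), (∀ a i, X a i ≠ 0 ∧ ‖X a i‖ < 1) → (∀ a, Function.Injective (X a)) → (Matrix.of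 fun a b : Fin m => (∏ i, ‖X b i‖ ^ (-(2 * Δ))) * S (k a + k b) (Fin.append (X a) (fun i => EuclideanGeometry.inversion 0 1 (X b i)))).PosSemidef) → Literature.Probability.LatticeModels.IsMoebiusCovariant Δ S

-- `MoebiusOfInversionPositive` holds: proved by `Summit.CriticalPhenomena.Ising3DConformalLimit.PositivityBegetsConformalityMoebiusOfInversionPositive.moebiusOfInversionPositive_proof` @ 26ff6b64475b (its module imports this route file, so no `_holds` link can be stated here).

/-- item stmt-CriticalPhenomena-4674 · support · rank 9 · closed · proved by Summit.CriticalPhenomena.Ising3DConformalLimit.Theorems.positivityImpliesInversionCovariance_proof @ f42349d5b6d8 (prover) · by planner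
sources: GlimmJaffe1987, OsterwalderSchrader1973, Mack1975, FrancescoMathieuSenechal1997
[support] the Lemma (card P0), abstract over CorrFamily 3: if S vanishes off NonCoincident, is
permutation symmetric (S n (z ∘ σ) = S n z), scale covariant with Δ and inversion positive with
weight Δ (same matrix family as in InversionPositiveLimit), then IsInversionCovariant Δ S. Proof:
PosSemidef ⇒ symmetric Gram matrix, w(Y)S(X ⊔ ιY) = w(X)S(Y ⊔ ιX); a configuration Z avoiding 0 and
the unit sphere splits as Z = X ⊔ ιY with X = Z ∩ B, Y = ι(Z ∖ B̄), and the symmetry is S(ιZ) =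
∏‖z‖^(2Δ) S(Z) after a permutation; configurations touching the unit sphere: inversion positivity
w.r.t. the sphere of radius r follows by scale covariance (D_r conjugation multiplies M by a
positive diagonal matrix on both sides), pick r ∉ {‖z_i‖} and use ι = D_(1/r²) ∘ ι_r; coincident
configurations: both sides vanish (ι injective). Arity-0 configurations are allowed (S 0 of the
empty configuration is the vacuum entry). [difficulty: provable-now] -/
@[route_item "route-CriticalPhenomena-PositivityBegetsConformality"]
def PositivityImpliesInversionCovariance : Prop :=
  ∀ (Δ : ℝ) (S : Literature.Probability.LatticeModels.CorrFamily 3), (∀ n z, z ∉ Literature.Probability.LatticeModels.NonCoincident 3 n → S n z = 0) → (∀ (n : ℕ) (σ : Equiv.Perm (Fin n)) (z : Fin n → EuclideanSpace ℝ (Fin 3)), S n (fun i => z (σ i)) = S n z) → Literature.Probability.LatticeModels.IsScaleCovariant Δ S → (∀ (m : ℕ) (k : Fin m → ℕ) (X : (a : Fin m) → Fin (k a) → EuclideanSpace ℝ (Fin 3)), (∀ a i, X a i ≠ 0 ∧ ‖X a i‖ < 1) → (∀ a, Function.Injective (X a)) → (Matrix.of fun a b : Fin m => (∏ i, ‖X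 b i‖ ^ (-(2 * Δ))) * S (k a + k b) (Fin.append (X a) (fun i => EuclideanGeometry.inversion 0 1 (X b i)))).PosSemidef) → Literature.Probability.LatticeModels.IsInversionCovariant Δ S

-- `PositivityImpliesInversionCovariance` holds: proved by `Summit.CriticalPhenomena.Ising3DConformalLimit.Theorems.positivityImpliesInversionCovariance_proof` @ f42349d5b6d8 (its module imports this route file, so no `_holds` link can be stated here).

/-- item stmt-CriticalPhenomena-4675 · support · rank 9 · closed · proved by Summit.CriticalPhenomena.Ising3DConformalLimit.PrecisionLaplacianMoebiusLimitOfTwoPointLaw.stub_inversionBegetsRotations (prover) · by planner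
sources: FrancescoMathieuSenechal1997, BenedettiPetronio1992, doi:10.1007/978-3-319-43626-5_3
[support] the group lemma (card P4 = A0 of inversion-first-moebius-from-translations, in the form
its novelty audit recommended recording): for any Δ and any S : CorrFamily 3, IsTranslationInvariant
S and IsInversionCovariant Δ S imply IsRotationInvariant S (all of O(3)); no continuity, no scale
covariance, no normalisation needed. Proof: the reflection in the plane {y · a = 1/2}, ‖a‖ = 1,
equals ι ∘ τ_a ∘ ι ∘ τ_(−a) ∘ ι pointwise off the poles {0, a} (a plane reflection is the
ι-conjugate of the inversion in the unit sphere through 0 centred at a; checked numerically), and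
the three inversion weights multiply to 1 (‖w'‖·‖z − a‖·‖y‖ = 1); for a plane through 0 and a given
configuration x conjugate by a translation u with u · v = 1/2 avoiding the finitely many u that put
a point on a pole; O(3) is generated by reflections (Mathlib
LinearIsometryEquiv.reflections_generate / Cartan–Dieudonné). [difficulty: provable-now] -/
@[route_item "route-CriticalPhenomena-PositivityBegetsConformality"]
def InversionBegetsRotations : Prop :=
  ∀ (Δ : ℝ) (S : Literature.Probability.LatticeModels.CorrFamily 3), Literature.Probability.LatticeModels.IsTranslationInvariant S → Literature.Probability.LatticeModels.IsInversionCovariant Δ S → Literature.Probability.LatticeModels.IsRotationInvariant S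

-- `InversionBegetsRotations` holds: proved by `Summit.CriticalPhenomena.Ising3DConformalLimit.PrecisionLaplacianMoebiusLimitOfTwoPointLaw.stub_inversionBegetsRotations` (its module imports this route file, so no `_holds` link can be stated here).

/-- item stmt-CriticalPhenomena-4676 · support · rank 9 · closed · proved by Summit.CriticalPhenomena.Ising3DConformalLimit.Theorems.twoPointSpherePositivity_proof @ e434a0a71209 (prover) · by planner
sources: AndrewsAskeyRoy1999, NeebOlafsson2014, FrankLieb2010, doi:10.1215/S0012-7094-42-00908-6, BergChristensenRessel1984
[support] the 1|1 level is classical analysis (card P1): for Δ > 0, the kernel K_Δ(x,y) =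
‖y‖^(−2Δ)‖x − ιy‖^(−2Δ) = (1 − 2⟨x,y⟩ + ‖x‖²‖y‖²)^(−Δ) gives Matrix.PosSemidef matrices for all
finite families in the punctured open unit ball of ℝ³ IF AND ONLY IF Δ ≥ 1/2. (⇐) Gegenbauer
generating function Σ_n (‖x‖‖y‖)^n C_n^(Δ)(x̂·ŷ) (AndrewsAskeyRoy1999 (6.4.8)), connection
coefficients C_n^(Δ) → Legendre C_k^(1/2) non-negative for Δ ≥ 1/2 (Thm 7.1.4'), zonal Legendre
kernels PSD on S² (addition theorem / Schoenberg 1942), Schur products and limits; equivalently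
sphere-reflection positivity of ‖x − y‖^(−s), n − 2 ≤ s (NeebOlafsson2014 Thm 6.7, FrankLieb2010).
(⇒) for 0 < Δ < 1/2 the P₀-coefficient of C₂^(Δ) is Δ(2Δ−1)/3 < 0 and the regular octahedron (a
spherical 3-design) at radii 2r and r with weights ±1/6 gives quadratic form Δ(2Δ−1)/3·9r⁴ + O(r⁸) <
0 for small r (verified numerically down to Δ = 0.4999). So the two-point level of (IP) is automatic
exactly on the rigorous Ising window Δ ∈ [1/2,1] (scalingDimension_mem_Icc_holds) once S₂ is
isotropic, and conversely the 1|1 level of (IP) is EQUIVALENT to two-point isotropy there.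
[difficulty: L] -/
@[route_item "route-CriticalPhenomena-PositivityBegetsConformality"]
def TwoPointSpherePositivity : Prop :=
  ∀ Δ : ℝ, 0 < Δ → ((∀ (m : ℕ) (x : Fin m → EuclideanSpace ℝ (Fin 3)), (∀ a, x a ≠ 0 ∧ ‖x a‖ < 1) → (Matrix.of fun a b : Fin m => (1 - 2 * inner ℝ (x a) (x b) + ‖x a‖ ^ 2 * ‖x b‖ ^ 2) ^ (-Δ)).PosSemidef) ↔ 1 / 2 ≤ Δ)

-- `TwoPointSpherePositivity` holds: proved by `Summit.CriticalPhenomena.Ising3DConformalLimit.Theorems.twoPointSpherePositivity_proof` @ e434a0a71209 (its module imports this route file, so no `_holds` link can be stated here).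

/-- item stmt-CriticalPhenomena-4677 · assembly · rank 1 · closed · proved by Summit.CriticalPhenomena.Ising3DConformalLimit.Theorems.positivityBegetsConformality_assembly_proof @ 0b9e86ad3869 (prover) · by planner
sources: DuminilCopinICM2022, Mack1975
[assembly] InversionPositiveLimit → MoebiusOfInversionPositive → ExistsScaleCovariantLimit →
IsingEuclidUpgradeR4NonGaussian → Ising3DConformalLimit (the root abbrev of
Summits/CriticalPhenomena/Ising3DConformalLimit/Statement.lean). -/
@[route_item "route-CriticalPhenomena-PositivityBegetsConformality"]
def Assembly : Prop :=
  InversionPositiveLimit → MoebiusOfInversionPositive → ExistsScaleCovariantLimit → IsingEuclidUpgradeR4NonGaussian → Ising3DConformalLimit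

-- `Assembly` holds: proved by `Summit.CriticalPhenomena.Ising3DConformalLimit.Theorems.positivityBegetsConformality_assembly_proof` @ 0b9e86ad3869 (its module imports this route file, so no `_holds` link can be stated here).

/-! D-0027 §2.1 — DECIDING THEOREM (planner-authored via `route open/edit --closes-file`; by planner-rbadge-CriticalPhenomena-PositivityBeg-fb48c3f0-g4-0 2026-08-15T16:09:11Z):
its hypotheses are this route's items and its conclusion the sub-problem Statement (glue_lint), and it elaborates with this file. -/

@[closes "route-CriticalPhenomena-PositivityBegetsConformality"] theorem closes : InversionPositiveLimit → MoebiusOfInversionPositive → ExistsScaleCovariantLimit → IsingEuclidUpgradeR4NonGaussian → _root_.Ising3DConformalLimit := by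
  intro hIP hM hE hNG
  obtain ⟨ρ, Δ, S, hρ, hΔ, hlim, hnorm, hnd, htr, hsc⟩ := hE
  have hpos := hIP ρ Δ S hρ hlim hnorm hnd htr hsc
  have hMoeb : Literature.Probability.LatticeModels.IsMoebiusCovariant Δ S :=
    hM ρ Δ S hρ hlim hnorm hnd htr hsc hpos
  have hU4 : Literature.Probability.LatticeModels.HasNontrivialU4 S := hNG ρ S hρ hlim hnd
  exact ⟨ρ, Δ, S, hρ, hΔ, hlim, hnd, hMoeb, hU4⟩

end Summit.CriticalPhenomena.Ising3DConformalLimit.Theses.PositivityBegetsConformality
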